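import Summits.CriticalPhenomena.PercolationContinuityZ3.Theorems.Transplant.FKConnectivityAllQForestPathEdges
import Summits.CriticalPhenomena.PercolationContinuityZ3.Theorems.Transplant.FKConnectivityAllQTwoClusterFibres
import HarnessLib

/-!
# The level-one sign fact from quotient monotonicity

builds on p205010 (kernel theorem, internal audit signed; external expert review pending).  No definitions, no named facts, no sorries;
standard axioms.

Memo bschramm/FROM-fk-1-g20-SEPARATOR-EXCHANGE.md §3d.  Write `FM S` for the forest configurations in which the points of `S` are
pairwise separated ("forests of the quotient `G/S`").  QUOTIENT MONOTONICITY (QS-K) is the family of fibre inequalities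
`#(FM S ∩ {K ⊆ ω}, FM (T + y)) ≤ #(FM (S + y) ∩ {K ⊆ ω}, FM T)` for `S ⊆ T`, `y ∉ T`, `K` a set of fibre pairs on `T` forced into the
first class: identifying more vertices into one class makes the OTHER class attach `y` to it more often (house conjecture; 0 failures
in all exhaustive and random tests of the memo).  THIS FILE: (QS-K) implies the two-point attachment inequality behind the level-one
sign fact `n(pq,d;f) ≤ n(d,pq;f)` of `…PathGadgetStar`/`…PathGadgetAssembly`: on every fibre,
`#(FM{o,p,q}, Fo ∩ {p ~ q, o ≁ p, o ≁ q} ∩ {y ≁ o,p,q}) ≤ #(FM{o,p,q,y}, Fo ∩ {p ~ q, o ≁ p, o ≁ q})`.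
Proof: split both sides by the edge set `π` of the second class's `p–q` path; on a `π`-class, deleting `π` from the second class (its
doubled pairs `K = π ∩ u` stay in the first class) is the identity on fibre configurations and lands in the fibre
`((M ∖ π) ∪ K, u ∖ π)` with second class in `FM (V(π) + o (+ y))`; (QS-K) compares the two classes there; gluing `π` back
(`isForestCfg_union_of_separated`, `not_reachable_union_of_separated`, uniqueness of path edge sets) returns to the `π`-class of the
right-hand side.  All maps are identities, so only inclusions of finite sets are needed.
* `sdiff_reduce_pathEdges`, `sdiff_glue_pathEdges` — the fibre bookkeeping;
* **`forest_attach_le_of_quotientMono`** — the reduction.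
[cite: SempleWelsh2008, Conj. 1.1 (p. 2)] [cite: Linusson2011, Prop. 2.6] [cite: Grimmett2006, §4.2 Lemma (4.13)]
-/

noncomputable section

namespace Summit.CriticalPhenomena.PercolationContinuityZ3.Theorems

namespace FK

open Set SimpleGraph Literature.Probability.LatticeModels Literature.Probability.Percolation
open scoped Classical symmDiff

variable {V : Type*} [Fintype V]

section QuotientMono

variable {M u ω π : BondConfig V} {o p q y : V}

omit [Fintype V] in
/-- Fibre bookkeeping, forward: deleting the path `π ⊆ ω ∆ M` from the second class moves the configuration `ω` (unchanged) to the
fibre `((M ∖ π) ∪ (π ∩ u), u ∖ π)`, whose second class is `(ω ∆ M) ∖ π`. [folklore] -/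
theorem sdiff_reduce_pathEdges (hωM : ω \ M = u) (huM : Disjoint u M) (hπ : π ⊆ ω ∆ M) :
    ω \ ((M \ π) ∪ (π ∩ u)) = u \ π ∧ ω ∆ ((M \ π) ∪ (π ∩ u)) = (ω ∆ M) \ π := by
  have hx : ∀ x, x ∈ u ↔ x ∈ ω ∧ x ∉ M := fun x => by rw [← hωM]; exact Iff.rfl
  have hd : ∀ x, x ∈ u → x ∉ M := fun x hxu hxM => Set.disjoint_left.1 huM hxu hxM
  have hπ' : ∀ x, x ∈ π → (x ∈ ω ∧ x ∉ M) ∨ (x ∈ M ∧ x ∉ ω) := fun x hxπ => Set.mem_symmDiff.1 (hπ hxπ)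
  constructor
  · ext x
    simp only [mem_sdiff, mem_union, mem_inter_iff]
    have h1 := hx x; have h2 := hd x; have h3 := hπ' x
    tauto
  · ext x
    simp only [mem_sdiff, mem_union, mem_inter_iff, Set.mem_symmDiff]
    have h1 := hx x; have h2 := hd x; have h3 := hπ' x
    tauto

omit [Fintype V] in
/-- Fibre bookkeeping, backward: a configuration `ω'` on the fibre `((M ∖ π) ∪ (π ∩ u), u ∖ π)` containing `π ∩ u`, with
`π ⊆ M ∪ u`, lies on the fibre `(M, u)`, its second class there is the old second class plus `π`, and `π` misses the old second class.
[folklore] -/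
theorem sdiff_glue_pathEdges {ω' : BondConfig V} (hω : ω' \ ((M \ π) ∪ (π ∩ u)) = u \ π) (hK : π ∩ u ⊆ ω') (hπ : π ⊆ M ∪ u)
    (huM : Disjoint u M) :
    ω' \ M = u ∧ ω' ∆ M = (ω' ∆ ((M \ π) ∪ (π ∩ u))) ∪ π ∧ Disjoint π (ω' ∆ ((M \ π) ∪ (π ∩ u))) := by
  have hx : ∀ x, (x ∈ ω' ∧ ¬ (x ∈ M ∧ x ∉ π ∨ x ∈ π ∧ x ∈ u)) ↔ (x ∈ u ∧ x ∉ π) := by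
    intro x
    have h := Set.ext_iff.1 hω x
    simpa only [mem_sdiff, mem_union, mem_inter_iff] using h
  have hK' : ∀ x, x ∈ π → x ∈ u → x ∈ ω' := fun x hxπ hxu => hK ⟨hxπ, hxu⟩
  have hπ' : ∀ x, x ∈ π → x ∈ M ∨ x ∈ u := fun x hxπ => hπ hxπ
  have hd : ∀ x, x ∈ u → x ∉ M := fun x hxu hxM => Set.disjoint_left.1 huM hxu hxM
  refine ⟨?_, ?_, ?_⟩
  · ext x
    simp only [mem_sdiff]
    have h1 := hx x; have h2 := hK' x; have h3 := hπ' x; have h4 := hd x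
    tauto
  · ext x
    simp only [mem_sdiff, mem_union, mem_inter_iff, Set.mem_symmDiff]
    have h1 := hx x; have h2 := hK' x; have h3 := hπ' x; have h4 := hd x
    tauto
  · refine Set.disjoint_left.2 fun x hxπ hxB => ?_
    simp only [mem_sdiff, mem_union, mem_inter_iff, Set.mem_symmDiff] at hxB
    have h1 := hx x; have h2 := hK' x; have h3 := hπ' x; have h4 := hd x
    tauto

omit [Fintype V] in
/-- The endpoints of a path with distinct ends lie on its edges. [folklore] -/
theorem ends_mem_pathEdges {B : BondConfig V} (hpq : p ≠ q)
    (h : ∃ w : (openGraph B).Walk p q, w.IsPath ∧ π = {e | e ∈ w.edges}) :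
    (∃ e ∈ π, p ∈ e) ∧ (∃ e ∈ π, q ∈ e) := by
  obtain ⟨w, -, rfl⟩ := h
  constructor
  · cases w with
    | nil => exact absurd rfl hpq
    | @cons _ b _ hadj w' => exact ⟨s(p, b), by simp [Walk.edges_cons], Sym2.mem_mk_left _ _⟩
  · cases hw : w.reverse with
    | nil => exact absurd rfl hpq
    | @cons _ b _ hadj w' =>
      refine ⟨s(q, b), ?_, Sym2.mem_mk_left _ _⟩
      have : s(q, b) ∈ w.reverse.edges := by rw [hw]; simp [Walk.edges_cons]
      rw [Walk.edges_reverse, List.mem_reverse] at this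
      exact this

/-- **The two-point attachment inequality from quotient monotonicity** (memo §3d: (QS-K) ⇒ L1(i)).  `FM S` = forest configurations
separating the points of `S` pairwise; hypothesis `hQ` = the (QS-K) family on the vertex type `V`; conclusion = the fibre form of
`#{Ω : y ≁_B {o,p,q}} ≤ #{Ω : y ≁_A {o,p,q}}` on `Ω = {tr A = disc, tr B = {pq}}`, i.e. the sign fact `n(pq,d;f) ≤ n(d,pq;f)` after
removing the pinned pair `f = oy` and swapping the classes on one side. [cite: SempleWelsh2008, Conj. 1.1 (p. 2)]
[cite: Linusson2011, Prop. 2.6] [cite: Grimmett2006, §4.2 Lemma (4.13)] -/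
theorem forest_attach_le_of_quotientMono (FM : Set V → Set (BondConfig V))
    (hFM : ∀ (S : Set V) (ω : BondConfig V),
      ω ∈ FM S ↔ IsForestCfg ω ∧ ∀ x ∈ S, ∀ x' ∈ S, (openGraph ω).Reachable x x' → x = x')
    (hQ : ∀ (M' u' K : BondConfig V) (S T : Set V) (y' : V), Disjoint u' M' → K ⊆ M' → S ⊆ T → y' ∉ T →
      (∀ e ∈ K, ∀ x ∈ e, x ∈ T) →
      fibreCount M' u' (FM S ∩ {ω | K ⊆ ω}) (FM (insert y' T)) ≤ fibreCount M' u' (FM (insert y' S) ∩ {ω | K ⊆ ω}) (FM T))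
    (huM : Disjoint u M) (hop : o ≠ p) (hoq : o ≠ q) (hpq : p ≠ q) (hyo : y ≠ o) :
    fibreCount M u (FM {o, p, q})
        (forestEv V ∩ {ω | (openGraph ω).Reachable p q ∧ ¬ (openGraph ω).Reachable o p ∧ ¬ (openGraph ω).Reachable o q} ∩
          {ω | ¬ (openGraph ω).Reachable y o ∧ ¬ (openGraph ω).Reachable y p ∧ ¬ (openGraph ω).Reachable y q}) ≤
      fibreCount M u (FM (insert y {o, p, q}))
        (forestEv V ∩ {ω | (openGraph ω).Reachable p q ∧ ¬ (openGraph ω).Reachable o p ∧ ¬ (openGraph ω).Reachable o q}) := by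
  -- the path edge set of the second class
  let Φ : BondConfig V → Set (Sym2 V) := fun B =>
    if h : (openGraph B).Reachable p q then Classical.choose (exists_pathEdges h) else ∅
  have hΦ : ∀ B : BondConfig V, (openGraph B).Reachable p q →
      ∃ w : (openGraph B).Walk p q, w.IsPath ∧ Φ B = {e | e ∈ w.edges} := by
    intro B h
    simp only [Φ, dif_pos h]
    exact Classical.choose_spec (exists_pathEdges h)
  unfold fibreCount
  have hfib : ∀ s : Finset (BondConfig V),
      s.card = ∑ b ∈ (Finset.univ : Finset (Set (Sym2 V))), (s.filter fun a => Φ (a ∆ M) = b).card :=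
    fun s => Finset.card_eq_sum_card_fiberwise fun _ _ => Finset.mem_univ _
  conv_lhs => rw [hfib]
  conv_rhs => rw [hfib]
  refine Finset.sum_le_sum fun π _ => ?_
  -- one path class: either it is empty on the left, or `π` is the edge set of a `p–q` path in some forest
  by_cases hex : ∃ B : BondConfig V, IsForestCfg B ∧ (∃ w : (openGraph B).Walk p q, w.IsPath ∧ π = {e | e ∈ w.edges}) ∧
      ¬ (openGraph B).Reachable o p ∧ ¬ (openGraph B).Reachable y p ∧ π ⊆ M ∪ u
  swap
  · refine Finset.card_le_card fun ω hω => (hex ?_).elim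
    simp only [Finset.mem_filter, Finset.mem_univ, true_and, mem_inter_iff, mem_setOf_eq] at hω
    obtain ⟨⟨hωM, -, ⟨hBF, hBpq, hBop, -⟩, -, hByp, -⟩, hωπ⟩ := hω
    obtain ⟨w, hw, hwe⟩ := hΦ _ hBpq
    have hπB : ∃ w : (openGraph (ω ∆ M)).Walk p q, w.IsPath ∧ π = {e | e ∈ w.edges} := ⟨w, hw, by rw [← hωπ, hwe]⟩
    refine ⟨ω ∆ M, hBF, hπB, hBop, hByp, fun x hx => ?_⟩
    rcases Set.mem_symmDiff.1 (pathEdges_subset hπB hx) with h | h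
    · exact Or.inr (by rw [← hωM]; exact h)
    · exact Or.inl h.1
  obtain ⟨B₀, hB₀F, hπ, hB₀op, hB₀yp, hπMu⟩ := hex
  have hπB₀ : π ⊆ B₀ := pathEdges_subset hπ
  have hπF : IsForestCfg π := isForestCfg_of_subset hB₀F hπB₀
  obtain ⟨hpV, hqV⟩ := ends_mem_pathEdges hpq hπ
  have hoV : ∀ e ∈ π, o ∉ e := fun e he hoe =>
    hB₀op ((reachable_of_mem_pathEdges hπ ⟨e, he, hoe⟩).symm)
  have hyV : ∀ e ∈ π, y ∉ e := fun e he hye =>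
    hB₀yp ((reachable_of_mem_pathEdges hπ ⟨e, he, hye⟩).symm)
  -- the reduced fibre and the separated set `T = V(π) + o`
  obtain ⟨T, hT⟩ : ∃ T : Set V, T = insert o {x | ∃ e ∈ π, x ∈ e} := ⟨_, rfl⟩
  have hπT : ∀ e ∈ π, ∀ x ∈ e, x ∈ T := fun e he x hx => by rw [hT]; exact mem_insert_of_mem _ ⟨e, he, hx⟩
  have hoT : o ∈ T := by rw [hT]; exact mem_insert _ _
  have hpT : p ∈ T := by rw [hT]; exact mem_insert_of_mem _ hpV
  have hqT : q ∈ T := by rw [hT]; exact mem_insert_of_mem _ hqV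
  have hST : ({o, p, q} : Set V) ⊆ T := by
    intro x hx
    simp only [mem_insert_iff, mem_singleton_iff] at hx
    rcases hx with rfl | rfl | rfl
    exacts [hoT, hpT, hqT]
  have hyT : y ∉ T := by
    rw [hT]
    rintro (rfl | ⟨e, he, hye⟩)
    · exact hyo rfl
    · exact hyV e he hye
  have hKT : ∀ e ∈ π ∩ u, ∀ x ∈ e, x ∈ T := fun e he x hx => hπT e he.1 x hx
  have hKM : π ∩ u ⊆ (M \ π) ∪ (π ∩ u) := subset_union_right
  have hd' : Disjoint (u \ π) ((M \ π) ∪ (π ∩ u)) := by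
    refine Set.disjoint_left.2 fun x hx hx' => ?_
    rcases hx' with h | h
    · exact Set.disjoint_left.1 huM hx.1 h.1
    · exact hx.2 h.1
  have key := hQ ((M \ π) ∪ (π ∩ u)) (u \ π) (π ∩ u) {o, p, q} T y hd' hKM hST hyT hKT
  unfold fibreCount at key
  refine le_trans (Finset.card_le_card fun ω hω => ?_) (le_trans key (Finset.card_le_card fun ω hω => ?_))
  · -- forward: delete `π` from the second class
    simp only [Finset.mem_filter, Finset.mem_univ, true_and, mem_inter_iff, mem_setOf_eq] at hω ⊢
    obtain ⟨⟨hωM, hωA, ⟨hBF, hBpq, hBop, hBoq⟩, hByo, hByp, hByq⟩, hωπ⟩ := hω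
    have hπB : ∃ w : (openGraph (ω ∆ M)).Walk p q, w.IsPath ∧ π = {e | e ∈ w.edges} := by
      obtain ⟨w, hw, hwe⟩ := hΦ _ hBpq
      exact ⟨w, hw, by rw [← hωπ, hwe]⟩
    have hπBs : π ⊆ ω ∆ M := pathEdges_subset hπB
    obtain ⟨h1, h2⟩ := sdiff_reduce_pathEdges hωM huM hπBs
    have huω : u ⊆ ω := fun x hx => by rw [← hωM] at hx; exact hx.1
    refine ⟨h1, ⟨hωA, fun x hx => huω hx.2⟩, ?_⟩
    rw [h2, hFM]
    have hle : openGraph ((ω ∆ M) \ π) ≤ openGraph (ω ∆ M) := fromEdgeSet_mono sdiff_subset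
    refine ⟨isForestCfg_of_subset hBF sdiff_subset, fun x hx x' hx' hr => ?_⟩
    rw [hT] at hx hx'
    rcases hx with rfl | rfl | hxV <;> rcases hx' with rfl | rfl | hx'V
    · rfl
    · exact absurd (hr.mono hle) hByo
    · exact absurd ((reachable_of_mem_pathEdges hπB hx'V).trans (hr.mono hle).symm).symm hByp
    · exact absurd (hr.mono hle).symm hByo
    · rfl
    · exact absurd ((hr.mono hle).trans (reachable_of_mem_pathEdges hπB hx'V).symm) hBop
    · exact absurd ((reachable_of_mem_pathEdges hπB hxV).trans (hr.mono hle)).symm hByp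
    · exact absurd ((hr.mono hle).symm.trans (reachable_of_mem_pathEdges hπB hxV).symm) hBop
    · exact eq_of_reachable_diff_pathEdges hBF hπB hxV hx'V hr
  · -- backward: glue `π` back onto the second class
    simp only [Finset.mem_filter, Finset.mem_univ, true_and, mem_inter_iff, mem_setOf_eq] at hω ⊢
    obtain ⟨hωM, ⟨hωA, hωK⟩, hωB⟩ := hω
    rw [hFM] at hωB
    obtain ⟨hB'F, hB'sep⟩ := hωB
    obtain ⟨g1, g2, g3⟩ := sdiff_glue_pathEdges hωM hωK hπMu huM
    have hF : IsForestCfg (ω ∆ M) := by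
      rw [g2, union_comm]
      exact isForestCfg_union_of_separated hπT hB'sep g3 hπF hB'F
    have hπω : π ⊆ ω ∆ M := by rw [g2]; exact subset_union_right
    have hreach : (openGraph (ω ∆ M)).Reachable p q := reachable_of_pathEdges_subset hπ hπω
    have hop' : ¬ (openGraph (ω ∆ M)).Reachable o p := by
      rw [g2, union_comm]
      exact not_reachable_union_of_separated hπT hB'sep hoT hpT hop hoV
    have hoq' : ¬ (openGraph (ω ∆ M)).Reachable o q := by
      rw [g2, union_comm]
      exact not_reachable_union_of_separated hπT hB'sep hoT hqT hoq hoV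
    refine ⟨⟨g1, hωA, hF, hreach, hop', hoq'⟩, ?_⟩
    obtain ⟨w, hw, hwe⟩ := hΦ _ hreach
    exact pathEdges_unique hF ⟨w, hw, hwe⟩ (pathEdges_transfer hπ hπω)

end QuotientMono

end FK

end Summit.CriticalPhenomena.PercolationContinuityZ3.Theorems
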